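import Literature.Analysis.Complex.OsgoodProofs
import Mathlib.Analysis.Calculus.MeanValue
import Mathlib.Analysis.SpecialFunctions.ExpDeriv
import HarnessLib

/-!
# Rigidity of the cubic theta identity (the analytic heart of Lefschetz's embedding theorem)

Let `θ` be an entire function on a finite-dimensional complex vector space `E`, `θ ≢ 0`. In the
classical proof that the theta functions of level `3` embed a complex torus (Lefschetz's theorem;
Griffiths–Harris, *Principles of Algebraic Geometry*, Ch. 2 §6 "The Lefschetz theorem", proof of
the embedding theorem pp. 338–340; Mumford, *Abelian Varieties*, §3 Thm. of Lefschetz, Steps III–IV,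
pp. 30–33; Lange–Birkenhake, *Complex Abelian Varieties*, Thm. 4.5.1) the two key steps are:

* **(injectivity)** if two points `z₁, z₂` are not separated by the sections `θ(z+a)θ(z+b)θ(z-a-b)`
  of `L³`, i.e. `θ(z₂+a)θ(z₂+b)θ(z₂-a-b) = γ · θ(z₁+a)θ(z₁+b)θ(z₁-a-b)` for all `a, b`, then
  `θ(x + (z₂ - z₁)) = C · e^{ℓ(x)} · θ(x)` for a constant `C ≠ 0` and a `ℂ`-linear form `ℓ`
  ("the function `θ(z + w)/θ(z)` is nowhere zero and entire, its logarithmic derivative is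
  periodic, hence it is `e^{linear}`");
* **(immersion)** the infinitesimal version: if a tangent vector `v` at `z` is killed, i.e. the
  `v`-derivative `D = ∂_v θ` satisfies the Leibniz form
  `D(z+a)θ(z+b)θ(z-a-b) + θ(z+a)D(z+b)θ(z-a-b) + θ(z+a)θ(z+b)D(z-a-b) = μ θ(z+a)θ(z+b)θ(z-a-b)`,
  then `D = (c + ℓ) · θ` for a constant `c` and a linear form `ℓ`.

This file proves both conclusions for an ARBITRARY entire `θ ≢ 0` (and arbitrary entire `D`), on
any finite-dimensional `E`, with fully elementary several-complex-variables arguments: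

* `eq_of_eventuallyEq`, `eq_zero_of_mul_eq_zero`, `exists_ne_zero_and_ne_zero` — entire functions
  on `E` form an integral domain (identity theorem via Osgood's lemma,
  `SCV.analyticOnNhd_of_differentiableOn`);
* `exp_of_local_mul_eq` — a local multiplicative Cauchy equation `h(α+t)h(p) = h(α)h(p+t)` near
  `p` forces `h = h(p) e^{ℓ(·-p)}` near `p`; `affine_of_local_add_eq` — the additive analogue;
* `quartic_of_cubic_translate`, `quartic_of_cubic_leibniz` — elimination of the third factor
  `θ(z-a-b)` (which does not change under `(a, b) ↦ (a+t, b-t)`) by the integral-domain property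
  on `E × E × E`;
* `translate_rigidity_of_quartic`, `leibniz_rigidity_of_quartic` — from the quartic identities to
  `A = C e^{ℓ} θ`, `D = (c + ℓ) θ` (local Cauchy equation at a common non-zero of `A, θ`, then the
  identity theorem);
* **`exists_exp_linear_of_cubic_translate`**, **`exists_affine_of_cubic_leibniz`** — the two
  rigidity theorems as used by Lefschetz's theorem.

Everything is proved; no definitions, no named facts. The periodicity arguments turning these into
"`z₂ - z₁` is a lattice vector" and "`v = 0`" for the Riemann theta function live with the theta
function (`Literature/Analysis/SpecialFunctions/RiemannThetaLefschetz.lean`).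

## References

* [GriffithsHarris1978] P. Griffiths, J. Harris, Principles of Algebraic Geometry, Wiley 1978,
  Ch. 2 §6, "The Lefschetz theorem" (embedding by theta functions, pp. 338–340).
* [MumfordAV1970] D. Mumford, Abelian Varieties, Oxford UP 1970, §3 (Theorem of Lefschetz, pp. 29–33).
* [LangeBirkenhake1992] H. Lange, Ch. Birkenhake, Complex Abelian Varieties, Springer 1992, Thm. 4.5.1.
* [HormanderSCV1973] L. Hörmander, An Introduction to Complex Analysis in Several Variables, Thm. 2.2.6
  (Osgood's lemma, used through the tree's `SCV.analyticOnNhd_of_differentiableOn`).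
-/

noncomputable section

open Complex Metric Set Filter
open scoped Topology

namespace Literature.Analysis.Complex

namespace ThetaRigidity

variable {E : Type*} [NormedAddCommGroup E] [NormedSpace ℂ E] [FiniteDimensional ℂ E]

/-! ### Entire functions on `E` form an integral domain -/

/-- An entire function on a finite-dimensional space is analytic everywhere (Osgood).
[cite: HormanderSCV1973, Thm 2.2.6] -/
theorem analyticOnNhd_univ {f : E → ℂ} (hf : Differentiable ℂ f) : AnalyticOnNhd ℂ f univ :=
  SCV.analyticOnNhd_of_differentiableOn hf.differentiableOn isOpen_univ

/-- **Identity theorem, global form**: two entire functions which agree near one point agree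
everywhere. [cite: HormanderSCV1973, Thm 2.2.6] -/
theorem eq_of_eventuallyEq {f g : E → ℂ} (hf : Differentiable ℂ f) (hg : Differentiable ℂ g)
    {p : E} (h : f =ᶠ[𝓝 p] g) : f = g := by
  have key := (analyticOnNhd_univ hf).eqOn_of_preconnected_of_eventuallyEq (analyticOnNhd_univ hg)
    isPreconnected_univ (mem_univ p) h
  exact funext fun x => key (mem_univ x)

/-- **Entire functions form an integral domain**: if `f · g = 0` and `g(x₀) ≠ 0` then `f = 0`.
[folklore] -/
theorem eq_zero_of_mul_eq_zero {f g : E → ℂ} (hf : Differentiable ℂ f) (hg : Differentiable ℂ g)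
    (h : ∀ x, f x * g x = 0) {x₀ : E} (hx₀ : g x₀ ≠ 0) : f = 0 := by
  have hne : ∀ᶠ x in 𝓝 x₀, g x ≠ 0 := (hg.continuous.continuousAt (x := x₀)).eventually_ne hx₀
  refine eq_of_eventuallyEq hf (differentiable_const (0 : ℂ)) (p := x₀) ?_
  filter_upwards [hne] with x hx
  exact (mul_eq_zero.mp (h x)).resolve_right hx

/-- A pointwise-zero product of entire functions has a zero factor. [folklore] -/
theorem eq_zero_or_eq_zero_of_mul_eq_zero {f g : E → ℂ} (hf : Differentiable ℂ f)
    (hg : Differentiable ℂ g) (h : ∀ x, f x * g x = 0) : f = 0 ∨ g = 0 := by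
  by_cases hg0 : g = 0
  · exact Or.inr hg0
  · obtain ⟨x₀, hx₀⟩ := Function.ne_iff.mp hg0
    exact Or.inl (eq_zero_of_mul_eq_zero hf hg h hx₀)

/-- Two entire functions, neither identically zero, have a common non-zero. [folklore] -/
theorem exists_ne_zero_and_ne_zero {f g : E → ℂ} (hf : Differentiable ℂ f) (hg : Differentiable ℂ g)
    (hf0 : f ≠ 0) (hg0 : g ≠ 0) : ∃ x, f x ≠ 0 ∧ g x ≠ 0 := by
  by_contra! hc
  have hmul : ∀ x, f x * g x = 0 := fun x => by
    by_cases hx : f x = 0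
    · rw [hx, zero_mul]
    · rw [hc x hx, mul_zero]
  rcases eq_zero_or_eq_zero_of_mul_eq_zero hf hg hmul with h | h
  · exact hf0 h
  · exact hg0 h

omit [NormedSpace ℂ E] [FiniteDimensional ℂ E] in
/-- A non-vanishing point of finitely many continuous functions persists on a ball. [folklore] -/
theorem exists_ball_forall_ne_zero {f g : E → ℂ} (hf : Continuous f) (hg : Continuous g) {p : E}
    (hfp : f p ≠ 0) (hgp : g p ≠ 0) :
    ∃ r > 0, ∀ x ∈ ball p r, f x ≠ 0 ∧ g x ≠ 0 := by
  have ho : IsOpen ({x | f x ≠ 0} ∩ {x | g x ≠ 0}) :=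
    (isOpen_ne_fun hf continuous_const).inter (isOpen_ne_fun hg continuous_const)
  obtain ⟨r, hr, hsub⟩ := Metric.isOpen_iff.mp ho p ⟨hfp, hgp⟩
  exact ⟨r, hr, fun x hx => hsub hx⟩

/-! ### Local Cauchy functional equations -/

omit [NormedSpace ℂ E] [FiniteDimensional ℂ E] in
/-- Membership bookkeeping: `α ∈ B(p, r/2)`, `t ∈ B(0, r/2)` ⇒ `α + t ∈ B(p, r)`. [folklore] -/
theorem add_mem_ball_of_mem_ball_half {p α t : E} {r : ℝ} (hα : α ∈ ball p (r / 2))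
    (ht : t ∈ ball (0 : E) (r / 2)) : α + t ∈ ball p r := by
  rw [mem_ball, dist_eq_norm] at hα ht ⊢
  rw [sub_zero] at ht
  calc ‖α + t - p‖ = ‖(α - p) + t‖ := by abel_nf
    _ ≤ ‖α - p‖ + ‖t‖ := norm_add_le _ _
    _ < r / 2 + r / 2 := add_lt_add hα ht
    _ = r := by ring

omit [FiniteDimensional ℂ E] in
/-- **Local multiplicative Cauchy equation ⇒ exponential.** If `h` is holomorphic on `B(p, r)`,
`h(p) ≠ 0`, and `h(α + t) h(p) = h(α) h(p + t)` for `α ∈ B(p, r/2)`, `t ∈ B(0, r/2)`, then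
`h(x) = h(p) exp(ℓ(x - p))` on `B(p, r/2)` for the linear form `ℓ = h(p)⁻¹ dh(p)`: differentiating
in `t` at `0` gives `dh(α) = (h(α)/h(p)) dh(p)`, so `h e^{-ℓ(·-p)}` has zero derivative on the ball.
[cite: GriffithsHarris1978, Ch. 2 §6 (proof of the Lefschetz theorem)] -/
theorem exp_of_local_mul_eq {h : E → ℂ} {p : E} {r : ℝ}
    (hd : DifferentiableOn ℂ h (ball p r)) (hp : h p ≠ 0)
    (hfe : ∀ α ∈ ball p (r / 2), ∀ t ∈ ball (0 : E) (r / 2), h (α + t) * h p = h α * h (p + t)) :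
    ∃ ℓ : E →L[ℂ] ℂ, ∀ x ∈ ball p (r / 2), h x = h p * cexp (ℓ (x - p)) := by
  by_cases hr : 0 < r
  swap
  · refine ⟨0, fun x hx => ?_⟩
    exact absurd (nonempty_ball.mp ⟨x, hx⟩) (by linarith)
  set ℓ : E →L[ℂ] ℂ := (h p)⁻¹ • fderiv ℂ h p with hℓ
  have hball2 : ball p (r / 2) ⊆ ball p r := ball_subset_ball (by linarith)
  have hdiffAt : ∀ x ∈ ball p r, DifferentiableAt ℂ h x := fun x hx =>
    hd.differentiableAt (isOpen_ball.mem_nhds hx)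
  -- Step 1: `dh(α) = h(α) • ℓ` on `B(p, r/2)`
  have hderiv : ∀ α ∈ ball p (r / 2), fderiv ℂ h α = h α • ℓ := by
    intro α hα
    have hp0 : (0 : E) ∈ ball (0 : E) (r / 2) := mem_ball_self (by linarith)
    -- the two sides of the functional equation, as functions of `t`, agree near `0`
    have heq : (fun t => h (α + t) * h p) =ᶠ[𝓝 (0 : E)] fun t => h α * h (p + t) := by
      filter_upwards [isOpen_ball.mem_nhds hp0] with t ht
      exact hfe α hα t ht
    have h1 := heq.fderiv_eq (𝕜 := ℂ)
    have hα' : HasFDerivAt h (fderiv ℂ h α) (α + 0) := by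
      rw [add_zero]; exact (hdiffAt α (hball2 hα)).hasFDerivAt
    have hp' : HasFDerivAt h (fderiv ℂ h p) (p + 0) := by
      rw [add_zero]; exact (hdiffAt p (mem_ball_self hr)).hasFDerivAt
    have hl : HasFDerivAt (fun t => h (α + t) * h p) (h p • fderiv ℂ h α) 0 :=
      ((hasFDerivAt_comp_add_left (f := h) α).mpr hα').mul_const (h p)
    have hr' : HasFDerivAt (fun t => h α * h (p + t)) (h α • fderiv ℂ h p) 0 :=
      ((hasFDerivAt_comp_add_left (f := h) p).mpr hp').const_mul (h α)
    rw [hl.fderiv, hr'.fderiv] at h1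
    rw [hℓ, smul_smul]
    calc fderiv ℂ h α = (h p)⁻¹ • (h p • fderiv ℂ h α) := by
          rw [smul_smul, inv_mul_cancel₀ hp, one_smul]
      _ = (h α * (h p)⁻¹) • fderiv ℂ h p := by rw [h1, smul_smul, mul_comm]
  -- Step 2: `k = h · exp(-ℓ(· - p))` has zero derivative on `B(p, r/2)`
  set k : E → ℂ := fun x => h x * cexp (-(ℓ (x - p))) with hk
  have hk_deriv : ∀ x ∈ ball p (r / 2), HasFDerivAt k (0 : E →L[ℂ] ℂ) x := by
    intro x hx
    have hx' : DifferentiableAt ℂ h x := hdiffAt x (hball2 hx)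
    have h1 : HasFDerivAt h (h x • ℓ) x := hderiv x hx ▸ hx'.hasFDerivAt
    have h2 : HasFDerivAt (fun y => -(ℓ (y - p))) (-ℓ) x := by
      have : (fun y => -(ℓ (y - p))) = fun y => -(ℓ y - ℓ p) := by
        funext y; rw [map_sub]
      rw [this]
      exact (ℓ.hasFDerivAt.sub_const (ℓ p)).neg
    have h3 := h1.mul h2.cexp
    refine h3.congr_fderiv ?_
    rw [smul_smul, smul_smul, smul_neg, mul_comm, neg_add_cancel]
  have hk_const : ∀ x ∈ ball p (r / 2), k x = k p := fun x hx =>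
    isOpen_ball.is_const_of_fderiv_eq_zero (convex_ball p (r / 2)).isPreconnected
      (fun y hy => (hk_deriv y hy).differentiableAt.differentiableWithinAt)
      (fun y hy => (hk_deriv y hy).fderiv) hx (mem_ball_self (by linarith))
  refine ⟨ℓ, fun x hx => ?_⟩
  have e := hk_const x hx
  simp only [hk, sub_self, map_zero, neg_zero, Complex.exp_zero, mul_one] at e
  calc h x = h x * cexp (-(ℓ (x - p))) * cexp (ℓ (x - p)) := by
        rw [mul_assoc, ← Complex.exp_add, neg_add_cancel, Complex.exp_zero, mul_one]
    _ = h p * cexp (ℓ (x - p)) := by rw [e]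

omit [FiniteDimensional ℂ E] in
/-- **Local additive Cauchy equation ⇒ affine.** If `q` is holomorphic on `B(p, r)` and
`q(α + t) + q(p) = q(α) + q(p + t)` for `α ∈ B(p, r/2)`, `t ∈ B(0, r/2)`, then
`q(x) = q(p) + ℓ(x - p)` on `B(p, r/2)` with `ℓ = dq(p)`. [cite: GriffithsHarris1978, Ch. 2 §6 (proof of the Lefschetz theorem)] -/
theorem affine_of_local_add_eq {q : E → ℂ} {p : E} {r : ℝ}
    (hd : DifferentiableOn ℂ q (ball p r))
    (hfe : ∀ α ∈ ball p (r / 2), ∀ t ∈ ball (0 : E) (r / 2), q (α + t) + q p = q α + q (p + t)) :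
    ∃ ℓ : E →L[ℂ] ℂ, ∀ x ∈ ball p (r / 2), q x = q p + ℓ (x - p) := by
  by_cases hr : 0 < r
  swap
  · refine ⟨0, fun x hx => ?_⟩
    exact absurd (nonempty_ball.mp ⟨x, hx⟩) (by linarith)
  set ℓ : E →L[ℂ] ℂ := fderiv ℂ q p with hℓ
  have hball2 : ball p (r / 2) ⊆ ball p r := ball_subset_ball (by linarith)
  have hdiffAt : ∀ x ∈ ball p r, DifferentiableAt ℂ q x := fun x hx =>
    hd.differentiableAt (isOpen_ball.mem_nhds hx)
  have hderiv : ∀ α ∈ ball p (r / 2), fderiv ℂ q α = ℓ := by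
    intro α hα
    have hp0 : (0 : E) ∈ ball (0 : E) (r / 2) := mem_ball_self (by linarith)
    have heq : (fun t => q (α + t) + q p) =ᶠ[𝓝 (0 : E)] fun t => q α + q (p + t) := by
      filter_upwards [isOpen_ball.mem_nhds hp0] with t ht
      exact hfe α hα t ht
    have h1 := heq.fderiv_eq (𝕜 := ℂ)
    have hα' : HasFDerivAt q (fderiv ℂ q α) (α + 0) := by
      rw [add_zero]; exact (hdiffAt α (hball2 hα)).hasFDerivAt
    have hp' : HasFDerivAt q (fderiv ℂ q p) (p + 0) := by
      rw [add_zero]; exact (hdiffAt p (mem_ball_self hr)).hasFDerivAt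
    have hl : HasFDerivAt (fun t => q (α + t) + q p) (fderiv ℂ q α) 0 :=
      ((hasFDerivAt_comp_add_left (f := q) α).mpr hα').add_const (q p)
    have hr' : HasFDerivAt (fun t => q α + q (p + t)) (fderiv ℂ q p) 0 :=
      ((hasFDerivAt_comp_add_left (f := q) p).mpr hp').const_add (q α)
    rw [hl.fderiv, hr'.fderiv] at h1
    rw [hℓ, h1]
  set k : E → ℂ := fun x => q x - ℓ (x - p) with hk
  have hk_deriv : ∀ x ∈ ball p (r / 2), HasFDerivAt k (0 : E →L[ℂ] ℂ) x := by
    intro x hx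
    have hx' : DifferentiableAt ℂ q x := hdiffAt x (hball2 hx)
    have h1 : HasFDerivAt q ℓ x := hderiv x hx ▸ hx'.hasFDerivAt
    have h2 : HasFDerivAt (fun y => ℓ (y - p)) ℓ x := by
      have : (fun y => ℓ (y - p)) = fun y => ℓ y - ℓ p := by
        funext y; rw [map_sub]
      rw [this]
      exact ℓ.hasFDerivAt.sub_const (ℓ p)
    have h3 := h1.sub h2
    rwa [sub_self] at h3
  have hk_const : ∀ x ∈ ball p (r / 2), k x = k p := fun x hx =>
    isOpen_ball.is_const_of_fderiv_eq_zero (convex_ball p (r / 2)).isPreconnected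
      (fun y hy => (hk_deriv y hy).differentiableAt.differentiableWithinAt)
      (fun y hy => (hk_deriv y hy).fderiv) hx (mem_ball_self (by linarith))
  refine ⟨ℓ, fun x hx => ?_⟩
  have e := hk_const x hx
  simp only [hk, sub_self, map_zero, sub_zero] at e
  rw [← e, sub_add_cancel]

/-! ### From the quartic identities to rigidity -/

/-- **Translate rigidity.** `θ` entire, `θ ≢ 0`, `A` entire with the quartic identity
`A(α)A(β)θ(α+t)θ(β-t) = A(α+t)A(β-t)θ(α)θ(β)` for all `α, β, t`; then `A = C · e^{ℓ} · θ` for a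
constant `C` and a `ℂ`-linear form `ℓ` (at a common non-zero `p` of `A, θ` the quotient `h = A/θ`
satisfies the local multiplicative Cauchy equation — the identity with `β = p + t` — so
`A = h(p) e^{ℓ(·-p)} θ` near `p`, and everywhere by the identity theorem).
[cite: GriffithsHarris1978, Ch. 2 §6 (proof of the Lefschetz theorem)] [cite: MumfordAV1970, §3 (Theorem of Lefschetz, Step III)] -/
theorem translate_rigidity_of_quartic {θ A : E → ℂ} (hθ : Differentiable ℂ θ)
    (hA : Differentiable ℂ A) (hθ0 : θ ≠ 0)
    (h : ∀ α β t, A α * A β * θ (α + t) * θ (β - t) = A (α + t) * A (β - t) * θ α * θ β) :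
    ∃ (C : ℂ) (ℓ : E →L[ℂ] ℂ), ∀ x, A x = C * cexp (ℓ x) * θ x := by
  by_cases hA0 : A = 0
  · exact ⟨0, 0, fun x => by simp [hA0]⟩
  obtain ⟨p, hAp, hθp⟩ := exists_ne_zero_and_ne_zero hA hθ hA0 hθ0
  obtain ⟨r, hr, hball⟩ := exists_ball_forall_ne_zero hA.continuous hθ.continuous hAp hθp
  -- the quotient `A/θ` near `p`
  set hq : E → ℂ := fun x => A x * (θ x)⁻¹ with hhq
  have hqd : DifferentiableOn ℂ hq (ball p r) := fun x hx =>
    ((hA x).mul ((hθ x).inv (hball x hx).2)).differentiableWithinAt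
  have hqp : hq p ≠ 0 := mul_ne_zero hAp (inv_ne_zero hθp)
  have hfe : ∀ α ∈ ball p (r / 2), ∀ t ∈ ball (0 : E) (r / 2),
      hq (α + t) * hq p = hq α * hq (p + t) := by
    intro α hα t ht
    have hαt := add_mem_ball_of_mem_ball_half hα ht
    have hpt : p + t ∈ ball p r :=
      add_mem_ball_of_mem_ball_half (mem_ball_self (by linarith)) ht
    have hα1 : α ∈ ball p r := ball_subset_ball (by linarith) hα
    have key := h α (p + t) t
    rw [add_sub_cancel_right] at key
    have h1 := (hball _ hαt).2
    have h2 := (hball _ hpt).2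
    have h3 := (hball _ hα1).2
    simp only [hhq]
    field_simp
    linear_combination key.symm
  obtain ⟨ℓ, hℓ⟩ := exp_of_local_mul_eq hqd hqp hfe
  refine ⟨hq p * cexp (-(ℓ p)), ℓ, ?_⟩
  -- both sides are entire and agree near `p`
  have hF : Differentiable ℂ fun x => hq p * cexp (-(ℓ p)) * cexp (ℓ x) * θ x :=
    ((differentiable_const _).mul (ℓ.differentiable.cexp)).mul hθ
  have heq : A =ᶠ[𝓝 p] fun x => hq p * cexp (-(ℓ p)) * cexp (ℓ x) * θ x := by
    filter_upwards [isOpen_ball.mem_nhds (mem_ball_self (half_pos hr) : p ∈ ball p (r / 2))]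
      with x hx
    have hx1 : x ∈ ball p r := ball_subset_ball (by linarith) hx
    have hθx := (hball x hx1).2
    have e := hℓ x hx
    simp only [hhq] at e
    calc A x = A x * (θ x)⁻¹ * θ x := by field_simp
      _ = A p * (θ p)⁻¹ * cexp (ℓ (x - p)) * θ x := by rw [e]
      _ = A p * (θ p)⁻¹ * cexp (-(ℓ p)) * cexp (ℓ x) * θ x := by
          rw [map_sub, sub_eq_neg_add, Complex.exp_add]; ring
  exact congrFun (eq_of_eventuallyEq hA hF heq)

/-- **Leibniz rigidity.** `θ` entire, `θ ≢ 0`, `D` entire with the quartic identity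
`(D(α)θ(β) + θ(α)D(β)) θ(α+t)θ(β-t) = (D(α+t)θ(β-t) + θ(α+t)D(β-t)) θ(α)θ(β)` for all `α, β, t`;
then `D = (c + ℓ) · θ` for a constant `c` and a linear form `ℓ` (the quotient `q = D/θ` near a
non-zero `p` of `θ` satisfies the local additive Cauchy equation).
[cite: GriffithsHarris1978, Ch. 2 §6 (proof of the Lefschetz theorem)] [cite: MumfordAV1970, §3 (Theorem of Lefschetz, Step IV)] -/
theorem leibniz_rigidity_of_quartic {θ D : E → ℂ} (hθ : Differentiable ℂ θ)
    (hD : Differentiable ℂ D) (hθ0 : θ ≠ 0)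
    (h : ∀ α β t, (D α * θ β + θ α * D β) * θ (α + t) * θ (β - t) =
      (D (α + t) * θ (β - t) + θ (α + t) * D (β - t)) * θ α * θ β) :
    ∃ (c : ℂ) (ℓ : E →L[ℂ] ℂ), ∀ x, D x = (c + ℓ x) * θ x := by
  obtain ⟨p, hθp⟩ : ∃ p, θ p ≠ 0 := by simpa [Function.ne_iff] using hθ0
  obtain ⟨r, hr, hball⟩ := exists_ball_forall_ne_zero hθ.continuous hθ.continuous hθp hθp
  set q : E → ℂ := fun x => D x * (θ x)⁻¹ with hq
  have hqd : DifferentiableOn ℂ q (ball p r) := fun x hx =>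
    ((hD x).mul ((hθ x).inv (hball x hx).2)).differentiableWithinAt
  have hfe : ∀ α ∈ ball p (r / 2), ∀ t ∈ ball (0 : E) (r / 2),
      q (α + t) + q p = q α + q (p + t) := by
    intro α hα t ht
    have hαt := add_mem_ball_of_mem_ball_half hα ht
    have hpt : p + t ∈ ball p r :=
      add_mem_ball_of_mem_ball_half (mem_ball_self (by linarith)) ht
    have hα1 : α ∈ ball p r := ball_subset_ball (by linarith) hα
    have key := h α (p + t) t
    rw [add_sub_cancel_right] at key
    have h1 := (hball _ hαt).2
    have h2 := (hball _ hpt).2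
    have h3 := (hball _ hα1).2
    simp only [hq]
    field_simp
    linear_combination key.symm
  obtain ⟨ℓ, hℓ⟩ := affine_of_local_add_eq hqd hfe
  refine ⟨q p - ℓ p, ℓ, ?_⟩
  have hF : Differentiable ℂ fun x => (q p - ℓ p + ℓ x) * θ x :=
    ((differentiable_const _).add ℓ.differentiable).mul hθ
  have heq : D =ᶠ[𝓝 p] fun x => (q p - ℓ p + ℓ x) * θ x := by
    filter_upwards [isOpen_ball.mem_nhds (mem_ball_self (half_pos hr) : p ∈ ball p (r / 2))]
      with x hx
    have hx1 : x ∈ ball p r := ball_subset_ball (by linarith) hx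
    have hθx := (hball x hx1).2
    have e := hℓ x hx
    simp only [hq] at e
    calc D x = D x * (θ x)⁻¹ * θ x := by field_simp
      _ = (D p * (θ p)⁻¹ + ℓ (x - p)) * θ x := by rw [e]
      _ = (D p * (θ p)⁻¹ - ℓ p + ℓ x) * θ x := by rw [map_sub]; ring
  exact congrFun (eq_of_eventuallyEq hD hF heq)

/-! ### Elimination of the third factor -/

/-- **From the cubic translate identity to the quartic one.** If `θ ≢ 0` is entire and
`θ(z₂+a)θ(z₂+b)θ(z₂-a-b) = γ θ(z₁+a)θ(z₁+b)θ(z₁-a-b)` for all `a, b`, then `A = θ(· + (z₂-z₁))`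
satisfies `A(α)A(β)θ(α+t)θ(β-t) = A(α+t)A(β-t)θ(α)θ(β)`: apply the hypothesis at `(a, b)` and at
`(a+t, b-t)` (same third factor `θ(z₂-a-b)`), cross-multiply, and cancel the entire factor
`(a, b, t) ↦ θ(z₂-a-b) ≢ 0` in the integral domain of entire functions on `E³`.
[cite: GriffithsHarris1978, Ch. 2 §6 (proof of the Lefschetz theorem)] -/
theorem quartic_of_cubic_translate {θ : E → ℂ} (hθ : Differentiable ℂ θ) (hθ0 : θ ≠ 0)
    {z₁ z₂ : E} {γ : ℂ}
    (h : ∀ a b, θ (z₂ + a) * θ (z₂ + b) * θ (z₂ - a - b) =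
      γ * (θ (z₁ + a) * θ (z₁ + b) * θ (z₁ - a - b))) :
    ∀ α β t, θ (α + (z₂ - z₁)) * θ (β + (z₂ - z₁)) * θ (α + t) * θ (β - t) =
      θ (α + t + (z₂ - z₁)) * θ (β - t + (z₂ - z₁)) * θ α * θ β := by
  obtain ⟨x₀, hx₀⟩ : ∃ x₀, θ x₀ ≠ 0 := by simpa [Function.ne_iff] using hθ0
  -- the two players on `E × E × E ∋ (α, β, t)`
  set Φ : E × E × E → ℂ := fun x => θ (z₂ + z₁ + z₁ - x.1 - x.2.1) with hΦ
  set Ψ : E × E × E → ℂ := fun x =>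
    θ (x.1 + (z₂ - z₁)) * θ (x.2.1 + (z₂ - z₁)) * θ (x.1 + x.2.2) * θ (x.2.1 - x.2.2) -
      θ (x.1 + x.2.2 + (z₂ - z₁)) * θ (x.2.1 - x.2.2 + (z₂ - z₁)) * θ x.1 * θ x.2.1 with hΨ
  have hΦd : Differentiable ℂ Φ := hθ.comp (by fun_prop)
  have hΨd : Differentiable ℂ Ψ := by
    simp only [hΨ]
    exact ((((hθ.comp (by fun_prop)).mul (hθ.comp (by fun_prop))).mul
      (hθ.comp (by fun_prop))).mul (hθ.comp (by fun_prop))).sub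
      ((((hθ.comp (by fun_prop)).mul (hθ.comp (by fun_prop))).mul
      (hθ.comp (by fun_prop))).mul (hθ.comp (by fun_prop)))
  have hprod : ∀ x, Ψ x * Φ x = 0 := by
    rintro ⟨α, β, t⟩
    have H1 := h (α - z₁) (β - z₁)
    have H2 := h (α - z₁ + t) (β - z₁ - t)
    have e1 : z₂ + (α - z₁) = α + (z₂ - z₁) := by abel
    have e2 : z₂ + (β - z₁) = β + (z₂ - z₁) := by abel
    have e3 : z₂ - (α - z₁) - (β - z₁) = z₂ + z₁ + z₁ - α - β := by abel
    have e4 : z₁ + (α - z₁) = α := by abel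
    have e5 : z₁ + (β - z₁) = β := by abel
    have e6 : z₁ - (α - z₁) - (β - z₁) = z₁ + z₁ + z₁ - α - β := by abel
    have e7 : z₂ + (α - z₁ + t) = α + t + (z₂ - z₁) := by abel
    have e8 : z₂ + (β - z₁ - t) = β - t + (z₂ - z₁) := by abel
    have e9 : z₂ - (α - z₁ + t) - (β - z₁ - t) = z₂ + z₁ + z₁ - α - β := by abel
    have e10 : z₁ + (α - z₁ + t) = α + t := by abel
    have e11 : z₁ + (β - z₁ - t) = β - t := by abel
    have e12 : z₁ - (α - z₁ + t) - (β - z₁ - t) = z₁ + z₁ + z₁ - α - β := by abel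
    rw [e1, e2, e3, e4, e5, e6] at H1
    rw [e7, e8, e9, e10, e11, e12] at H2
    simp only [hΨ, hΦ]
    linear_combination θ (α + t) * θ (β - t) * H1 - θ α * θ β * H2
  have hΦ0 : Φ (z₂ + z₁ + z₁ - x₀, 0, 0) ≠ 0 := by
    simp only [hΦ]
    convert hx₀ using 2
    abel
  have hΨ0 := eq_zero_of_mul_eq_zero hΨd hΦd hprod hΦ0
  intro α β t
  have e := congrFun hΨ0 (α, β, t)
  simp only [hΨ, Pi.zero_apply] at e
  exact sub_eq_zero.mp e

/-- **From the cubic Leibniz identity to the quartic one.** If `θ ≢ 0`, `D` are entire and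
`D(z+a)θ(z+b)θ(z-a-b) + θ(z+a)D(z+b)θ(z-a-b) + θ(z+a)θ(z+b)D(z-a-b) = μ θ(z+a)θ(z+b)θ(z-a-b)` for all
`a, b`, then `(D(α)θ(β) + θ(α)D(β))θ(α+t)θ(β-t) = (D(α+t)θ(β-t) + θ(α+t)D(β-t))θ(α)θ(β)` for all
`α, β, t` (same elimination of the factor at `z-a-b`). [cite: GriffithsHarris1978, Ch. 2 §6 (proof of the Lefschetz theorem)] -/
theorem quartic_of_cubic_leibniz {θ D : E → ℂ} (hθ : Differentiable ℂ θ) (hD : Differentiable ℂ D)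
    (hθ0 : θ ≠ 0) {z : E} {μ : ℂ}
    (h : ∀ a b, D (z + a) * θ (z + b) * θ (z - a - b) + θ (z + a) * D (z + b) * θ (z - a - b) +
      θ (z + a) * θ (z + b) * D (z - a - b) = μ * (θ (z + a) * θ (z + b) * θ (z - a - b))) :
    ∀ α β t, (D α * θ β + θ α * D β) * θ (α + t) * θ (β - t) =
      (D (α + t) * θ (β - t) + θ (α + t) * D (β - t)) * θ α * θ β := by
  obtain ⟨x₀, hx₀⟩ : ∃ x₀, θ x₀ ≠ 0 := by simpa [Function.ne_iff] using hθ0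
  set Φ : E × E × E → ℂ := fun x => θ (z + z + z - x.1 - x.2.1) with hΦ
  set Ψ : E × E × E → ℂ := fun x =>
    (D x.1 * θ x.2.1 + θ x.1 * D x.2.1) * θ (x.1 + x.2.2) * θ (x.2.1 - x.2.2) -
      (D (x.1 + x.2.2) * θ (x.2.1 - x.2.2) + θ (x.1 + x.2.2) * D (x.2.1 - x.2.2)) *
        θ x.1 * θ x.2.1 with hΨ
  have hΦd : Differentiable ℂ Φ := hθ.comp (by fun_prop)
  have hΨd : Differentiable ℂ Ψ := by
    simp only [hΨ]
    refine (((((hD.comp (by fun_prop)).mul (hθ.comp (by fun_prop))).add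
      ((hθ.comp (by fun_prop)).mul (hD.comp (by fun_prop)))).mul (hθ.comp (by fun_prop))).mul
      (hθ.comp (by fun_prop))).sub ?_
    exact ((((hD.comp (by fun_prop)).mul (hθ.comp (by fun_prop))).add
      ((hθ.comp (by fun_prop)).mul (hD.comp (by fun_prop)))).mul (hθ.comp (by fun_prop))).mul
      (hθ.comp (by fun_prop))
  have hprod : ∀ x, Ψ x * Φ x = 0 := by
    rintro ⟨α, β, t⟩
    have H1 := h (α - z) (β - z)
    have H2 := h (α - z + t) (β - z - t)
    have e1 : z + (α - z) = α := by abel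
    have e2 : z + (β - z) = β := by abel
    have e3 : z - (α - z) - (β - z) = z + z + z - α - β := by abel
    have e7 : z + (α - z + t) = α + t := by abel
    have e8 : z + (β - z - t) = β - t := by abel
    have e9 : z - (α - z + t) - (β - z - t) = z + z + z - α - β := by abel
    rw [e1, e2, e3] at H1
    rw [e7, e8, e9] at H2
    simp only [hΨ, hΦ]
    linear_combination θ (α + t) * θ (β - t) * H1 - θ α * θ β * H2
  have hΦ0 : Φ (z + z + z - x₀, 0, 0) ≠ 0 := by
    simp only [hΦ]
    convert hx₀ using 2
    abel
  have hΨ0 := eq_zero_of_mul_eq_zero hΨd hΦd hprod hΦ0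
  intro α β t
  have e := congrFun hΨ0 (α, β, t)
  simp only [hΨ, Pi.zero_apply] at e
  exact sub_eq_zero.mp e

/-! ### The two rigidity theorems of Lefschetz's proof -/

/-- **Rigidity of the cubic translate identity** (injectivity step of Lefschetz's theorem, for an
arbitrary entire `θ ≢ 0` on a finite-dimensional space): if
`θ(z₂+a)θ(z₂+b)θ(z₂-a-b) = γ · θ(z₁+a)θ(z₁+b)θ(z₁-a-b)` for all `a, b`, then there are `C ≠ 0` and a
`ℂ`-linear form `ℓ` with `θ(x + (z₂ - z₁)) = C e^{ℓ(x)} θ(x)` for all `x`.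
[cite: GriffithsHarris1978, Ch. 2 §6 (proof of the Lefschetz theorem)] [cite: MumfordAV1970, §3 (Theorem of Lefschetz, Step III)] -/
theorem exists_exp_linear_of_cubic_translate {θ : E → ℂ} (hθ : Differentiable ℂ θ) (hθ0 : θ ≠ 0)
    {z₁ z₂ : E} {γ : ℂ}
    (h : ∀ a b, θ (z₂ + a) * θ (z₂ + b) * θ (z₂ - a - b) =
      γ * (θ (z₁ + a) * θ (z₁ + b) * θ (z₁ - a - b))) :
    ∃ (C : ℂ) (ℓ : E →L[ℂ] ℂ), C ≠ 0 ∧ ∀ x, θ (x + (z₂ - z₁)) = C * cexp (ℓ x) * θ x := by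
  have hA : Differentiable ℂ fun x => θ (x + (z₂ - z₁)) := hθ.comp (by fun_prop)
  obtain ⟨C, ℓ, hCℓ⟩ := translate_rigidity_of_quartic hθ hA hθ0
    (quartic_of_cubic_translate hθ hθ0 h)
  refine ⟨C, ℓ, ?_, hCℓ⟩
  rintro rfl
  obtain ⟨x₀, hx₀⟩ : ∃ x₀, θ x₀ ≠ 0 := by simpa [Function.ne_iff] using hθ0
  have e := hCℓ (x₀ - (z₂ - z₁))
  rw [sub_add_cancel, zero_mul, zero_mul] at e
  exact hx₀ e

/-- **Rigidity of the cubic Leibniz identity** (immersion step of Lefschetz's theorem, for an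
arbitrary entire `θ ≢ 0` and entire `D` on a finite-dimensional space): if
`D(z+a)θ(z+b)θ(z-a-b) + θ(z+a)D(z+b)θ(z-a-b) + θ(z+a)θ(z+b)D(z-a-b) = μ θ(z+a)θ(z+b)θ(z-a-b)` for all
`a, b`, then `D = (c + ℓ) θ` for a constant `c` and a `ℂ`-linear form `ℓ`.
[cite: GriffithsHarris1978, Ch. 2 §6 (proof of the Lefschetz theorem)] [cite: MumfordAV1970, §3 (Theorem of Lefschetz, Step IV)] -/
theorem exists_affine_of_cubic_leibniz {θ D : E → ℂ} (hθ : Differentiable ℂ θ)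
    (hD : Differentiable ℂ D) (hθ0 : θ ≠ 0) {z : E} {μ : ℂ}
    (h : ∀ a b, D (z + a) * θ (z + b) * θ (z - a - b) + θ (z + a) * D (z + b) * θ (z - a - b) +
      θ (z + a) * θ (z + b) * D (z - a - b) = μ * (θ (z + a) * θ (z + b) * θ (z - a - b))) :
    ∃ (c : ℂ) (ℓ : E →L[ℂ] ℂ), ∀ x, D x = (c + ℓ x) * θ x :=
  leibniz_rigidity_of_quartic hθ hD hθ0 (quartic_of_cubic_leibniz hθ hD hθ0 h)

end ThetaRigidity

end Literature.Analysis.Complex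

end
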